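import Literature.MathematicalPhysics.QuantumLattice.DWaveSourceThermalGibbsMixtureDefs
import Literature.MathematicalPhysics.QuantumLattice.DWaveSourceEnergyDensityEnsembles
import HarnessLib

/-!
# Thermal (grand-canonical Gibbs) states of the pair-sourced `t–t'` Hubbard torus as eigen-mixtures, and the
# energy–entropy window `e_src ≤ e_Ψ(ω) ≤ e_src + (log 4)/β` of their thermodynamic limits

Family `hubbard` (topic `MathematicalPhysics/QuantumLattice`); stage S2 of the Hubbard material oracle («certifier
families … `T > 0`», D-0096 (iii)): the `T`-axis of the pairing-RESPONSE annex of the certified box words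
(`Certificates/HubbardSquare_*_pinning_responseFloors_*`: at `T = 0` every translation-invariant density-`n`
minimiser of `E_h(t',U) = e_Φ − h·2Re P₀^d` has `Re ω(P₀^d) ≥ (floor − cap)/(2h)`). Companion of
`TorusSectorGibbsMixture` (canonical sector Gibbs states of the UNSOURCED torus, cap `e_Φ(ω) ≤ e(n) + s/β`) and of
`DWaveSourceNNNHoppingEnergyDensity{,Exists}` / `DWaveSourceEnergyDensityEnsembles` (the sourced grand-canonical
torus `A_L(t',U,μ,h) = dWaveSourceTorusTT' L t' U μ h = hubbardTorusTT' L 1 t' U − μN_L − h(Δ_d + Δ_d†)`, its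
thermodynamic-limit ground-state energy density `e_src = dWaveSourceEnergyDensityTT' t' U μ h`, the local objective
`E^src = dWaveSourceEnergyObsTT'` with `Re ω(E^src) = e_Ψ(ω)`, `Ψ = hubbardTTPrimeSourcedInteraction 1 t' U μ d h`,
and the variational principle `e_src ≤ e_Ψ(σ)` for translation-invariant `σ`).

The pair source breaks particle-number conservation, so the `T > 0` object is GRAND-CANONICAL: the Gibbs state
`ρ_{L,β} = e^{−βA_L}/tr e^{−βA_L}` on the whole Fock space, written (as in `TorusSectorGibbsMixture` §1–§2 with
the trivial coordinate sector) as the finite mixture of an orthonormal eigenbasis of `A_L` with Boltzmann weights,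
in the format of `InfVolFermionState.IsTorusLimitOfMixture`.

* §1 (objects named in `DWaveSourceThermalGibbsMixtureDefs`: `sourcedGibbsCount L = 4^{L²}`, `sourcedGibbs{Vector,Energy,Weight}TT'`): unit
  eigenvectors, weights `≥ 0` summing to `1`, and the finite-volume **energy–entropy cap**
  `Σ_i p_{L,i}E_{L,i} ≤ E₀(A_L) + L²(log 4)/β` (`sum_sourcedGibbsWeightTT'_mul_re_expect_le[_log_four]`:
  Gibbs' variational principle through `sum_canonicalWeight_mul_re_rayleigh_le` + `Matrix.minEnergyOn_top`).
* §2 torus limits `ω` of these mixtures along `Ls → ∞` (`β > 0`; all real `t', U, μ, h`):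
  `e_src ≤ e_Ψ(ω) ≤ e_src + (log 4)/β` (`IsTorusLimitOfMixture.meanEnergy_sourced_mem_Icc_of_sourcedGibbs` and its
  two halves; averaged expectations of `E^src` = energies per site by `torusAvgExpectAt_eq_expect_div_of_sum_relabel`
  with `sum_relabel_translate_dWaveSourceEnergyObsTT'`; `E₀(A_L)/L² → e_src` by `tendsto_dWaveSourceEnergyDensityTT'`;
  the floor is the variational principle at the translation-invariant `ω`).
* the `T > 0` pairing-RESPONSE FLOOR built on this window (Griffiths' argument for the thermal states) is the
  companion file `DWaveSourceThermalResponseFloor`.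

Reading: the cap costs `(log 4)·T` (the entropy density of `2L²` fermionic modes is at most `log 4` per site; no
density-dependent sharpening in the grand-canonical ensemble); the floor costs nothing. WHAT THIS IS NOT: a KMS /
infinite-volume Gibbs statement (the thermal object is the torus limit of finite-volume Gibbs states); a canonical
(fixed-density) statement; a number of record.

## Mathlib / tree search

`lean search 'gibbs.*dWaveSourceTorus|sourcedGibbs|IsTorusLimitOfMixture.*Sourced'`: only the finite-volume matrix
Gibbs CEILINGS of `HohenbergMerminWagnerPairingQuasiAverage`; no torus-limit thermal class of the sourced torus, no
`T > 0` response floor (2026-08-27). REUSED: `sectorEigenvalue/sectorEigenvector/canonicalWeight`,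
`sum_canonicalWeight_mul_re_rayleigh_le`, `star_sectorEigenvector_dotProduct(_self)`, `mulVec_sectorEigenvector`,
`re_rayleigh_sectorEigenvector`, `Matrix.minEnergyOn_top_holds`, `card_orb`, `dWaveSourceTorusTT'_isHermitian`,
`sum_relabel_translate_dWaveSourceEnergyObsTT'`, `tendsto_dWaveSourceEnergyDensityTT'`,
`dWaveSourceEnergyDensityTT'_le_meanEnergy_sourced`, `re_expect_dWaveSourceEnergyObsTT'`,
`torusAvgExpect_eq`, `torusAvgExpectAt_eq_expect_div_of_sum_relabel`, `exists_forall_le_injOn_proj`.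

## References

* R. B. Israel, *Convexity in the Theory of Lattice Gases* (1979), Lemma II.3.1, §I.3. [cite: Israel1979, Lemma II.3.1]
* T. Koma, H. Tasaki, J. Stat. Phys. 76 (1994) 745, §1. [cite: KomaTasaki1994, §1]
* D. Ruelle, *Statistical Mechanics: Rigorous Results* (1969), §3.4. [cite: Ruelle1969, §3.4]
* O. Bratteli, A. Kishimoto, D. W. Robinson, Commun. Math. Phys. 64 (1978) 41, Thm. 2.
  [cite: BratteliKishimotoRobinson1978, Thm. 2]
-/

noncomputable section

namespace Literature.MathematicalPhysics.QuantumLattice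

open Matrix Finset HubbardWave0 Literature.Probability.LatticeModels ThermodynamicLimit
open _root_.Filter
open scoped _root_.Topology ComplexOrder BigOperators

/-! ### §1 The grand-canonical Gibbs state of the pair-sourced torus as an eigen-mixture -/

section TorusGibbs

/-- Canonical (Boltzmann) weights are invariant under reindexing the family of energies (public copy of the
private helper of `TorusSectorGibbsMixture`). [cite: Israel1979, Lemma II.3.1] -/
theorem canonicalWeight_comp_equiv' {κ κ' : Type*} [Fintype κ] [Fintype κ'] (e : κ' ≃ κ) (β : ℝ)
    (E : κ → ℝ) (a : κ') :
    canonicalWeight β (E ∘ e) a = canonicalWeight β E (e a) := by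
  unfold canonicalWeight
  rw [show (∑ b, Real.exp (-(β * (E ∘ e) b))) = ∑ b, Real.exp (-(β * E b)) from
    Equiv.sum_comp e (fun b => Real.exp (-(β * E b)))]
  rfl


variable (tp U μ h : ℝ)

/-- Unfolding at a positive side: the energies are the eigenvalues of `A_L`. [cite: Israel1979, Lemma II.3.1] -/
theorem sourcedGibbsEnergyTT'_eq (L : ℕ) [NeZero L] (i : Fin (sourcedGibbsCount L)) :
    sourcedGibbsEnergyTT' tp U μ h L i =
      sectorEigenvalue (fun _ => True) (dWaveSourceTorusTT' L tp U μ h)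
        (dWaveSourceTorusTT'_isHermitian L tp U μ h) (sourcedGibbsIndex L i) := by
  rw [sourcedGibbsEnergyTT', dif_neg (NeZero.ne L)]

/-- Unfolding at a positive side: the components are the eigenvectors of `A_L`. [cite: Israel1979, Lemma II.3.1] -/
theorem sourcedGibbsVectorTT'_eq (L : ℕ) [NeZero L] (i : Fin (sourcedGibbsCount L)) :
    sourcedGibbsVectorTT' tp U μ h L i =
      sectorEigenvector (fun _ => True) (dWaveSourceTorusTT' L tp U μ h)
        (dWaveSourceTorusTT'_isHermitian L tp U μ h) (sourcedGibbsIndex L i) := by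
  rw [sourcedGibbsVectorTT', dif_neg (NeZero.ne L)]

/-- The components are unit vectors (positive side). [cite: Israel1979, Lemma II.3.1] -/
theorem star_sourcedGibbsVectorTT'_dotProduct_self (L : ℕ) [NeZero L] (i : Fin (sourcedGibbsCount L)) :
    star (sourcedGibbsVectorTT' tp U μ h L i) ⬝ᵥ sourcedGibbsVectorTT' tp U μ h L i = 1 := by
  rw [sourcedGibbsVectorTT'_eq]
  exact star_sectorEigenvector_dotProduct_self (fun _ => True) _ _ _

/-- The components are orthonormal (positive side). [cite: Israel1979, Lemma II.3.1] -/
theorem star_sourcedGibbsVectorTT'_dotProduct (L : ℕ) [NeZero L] (i j : Fin (sourcedGibbsCount L)) :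
    star (sourcedGibbsVectorTT' tp U μ h L i) ⬝ᵥ sourcedGibbsVectorTT' tp U μ h L j =
      if i = j then 1 else 0 := by
  rw [sourcedGibbsVectorTT'_eq, sourcedGibbsVectorTT'_eq, star_sectorEigenvector_dotProduct]
  simp only [EmbeddingLike.apply_eq_iff_eq]

/-- The components are eigenvectors: `A_L ψ_{L,i} = E_{L,i} ψ_{L,i}`. [cite: Israel1979, Lemma II.3.1] -/
theorem dWaveSourceTorusTT'_mulVec_sourcedGibbsVectorTT' (L : ℕ) [NeZero L] (i : Fin (sourcedGibbsCount L)) :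
    dWaveSourceTorusTT' L tp U μ h *ᵥ sourcedGibbsVectorTT' tp U μ h L i =
      ((sourcedGibbsEnergyTT' tp U μ h L i : ℝ) : ℂ) • sourcedGibbsVectorTT' tp U μ h L i := by
  rw [sourcedGibbsVectorTT'_eq, sourcedGibbsEnergyTT'_eq]
  exact mulVec_sectorEigenvector (fun _ => True) _ (fun _ _ hs _ => (hs trivial).elim) _

/-- The mean energy of a component is its energy: `Re⟨ψ_{L,i}, A_L ψ_{L,i}⟩ = E_{L,i}`.
[cite: Israel1979, Lemma II.3.1] -/
theorem re_expect_sourcedGibbsVectorTT' (L : ℕ) [NeZero L] (i : Fin (sourcedGibbsCount L)) :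
    (expect (dWaveSourceTorusTT' L tp U μ h) (sourcedGibbsVectorTT' tp U μ h L i)).re =
      sourcedGibbsEnergyTT' tp U μ h L i := by
  rw [sourcedGibbsVectorTT'_eq, sourcedGibbsEnergyTT'_eq]
  exact re_rayleigh_sectorEigenvector (fun _ => True) _ (fun _ _ hs _ => (hs trivial).elim) _

/-- The Gibbs weights are nonnegative. [cite: Israel1979, Lemma II.3.1] -/
theorem sourcedGibbsWeightTT'_nonneg (β : ℝ) (L : ℕ) (i : Fin (sourcedGibbsCount L)) :
    0 ≤ sourcedGibbsWeightTT' β tp U μ h L i :=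
  canonicalWeight_nonneg β _ i

/-- The Gibbs weights sum to one (the Fock space is never empty: the vacuum configuration).
[cite: Israel1979, Lemma II.3.1] -/
theorem sum_sourcedGibbsWeightTT' (β : ℝ) (L : ℕ) : ∑ i, sourcedGibbsWeightTT' β tp U μ h L i = 1 := by
  haveI : Nonempty (Fin (sourcedGibbsCount L)) := ⟨(sourcedGibbsIndex L).symm ⟨∅, trivial⟩⟩
  exact sum_canonicalWeight β _

/-- **The mixture has `4^{L²}` components** (all subsets of the `2L²` orbitals).
[cite: Israel1979, Lemma II.3.1] -/
theorem sourcedGibbsCount_eq (L : ℕ) : sourcedGibbsCount L = 4 ^ (L ^ 2) := by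
  rw [sourcedGibbsCount, Fintype.card_congr (Equiv.subtypeUnivEquiv fun _ => trivial), Fintype.card_finset]
  have : Fintype.card (Orb (FermionTorus 2 L)) = 2 * L ^ 2 := by
    rw [card_orb]
    simp [FermionTorus, sq]
  rw [this, pow_mul]
  norm_num

/-- `log #components ≤ L²·log 4` (entropy density at most `log 4` per site). [cite: Israel1979, Lemma II.3.1] -/
theorem log_sourcedGibbsCount_le (L : ℕ) :
    Real.log (sourcedGibbsCount L) ≤ Real.log 4 * (L : ℝ) ^ 2 := by
  have hle : (sourcedGibbsCount L : ℝ) ≤ (4 : ℝ) ^ (L ^ 2) := by exact_mod_cast (sourcedGibbsCount_eq L).le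
  have hpos : 0 < sourcedGibbsCount L := by rw [sourcedGibbsCount_eq]; positivity
  calc Real.log (sourcedGibbsCount L) ≤ Real.log ((4 : ℝ) ^ (L ^ 2)) :=
        Real.log_le_log (by exact_mod_cast hpos) hle
    _ = Real.log 4 * (L : ℝ) ^ 2 := by rw [Real.log_pow]; push_cast; ring

/-- **Finite-volume energy–entropy cap for the grand-canonical Gibbs state of the pair-sourced torus**:
`tr(ρ_{L,β} A_L) = Σ_i p_{L,i} E_{L,i} ≤ E₀(A_L) + log(4^{L²})/β` (`β > 0`, `L ≥ 1`; Gibbs' variational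
principle with `S ≤ log dim`). [cite: Israel1979, Lemma II.3.1] -/
theorem sum_sourcedGibbsWeightTT'_mul_re_expect_le (L : ℕ) [NeZero L] {β : ℝ} (hβ : 0 < β) :
    ∑ i, sourcedGibbsWeightTT' β tp U μ h L i *
        (expect (dWaveSourceTorusTT' L tp U μ h) (sourcedGibbsVectorTT' tp U μ h L i)).re ≤
      (dWaveSourceTorusTT' L tp U μ h).groundEnergy + Real.log (sourcedGibbsCount L) / β := by
  set A := dWaveSourceTorusTT' L tp U μ h with hAdef
  have hA : A.IsHermitian := dWaveSourceTorusTT'_isHermitian L tp U μ h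
  have hinv : ∀ s s' : Finset (Orb (FermionTorus 2 L)), ¬ (fun _ => True) s → (fun _ => True) s' → A s s' = 0 :=
    fun _ _ hs _ => (hs trivial).elim
  have hp : ∃ s : Finset (Orb (FermionTorus 2 L)), (fun _ => True) s := ⟨∅, trivial⟩
  have hK : ∀ v : Fock (Orb (FermionTorus 2 L)), v ∈ (⊤ : Submodule ℂ (Fock (Orb (FermionTorus 2 L)))) ↔
      ∀ s, ¬ (fun _ : Finset (Orb (FermionTorus 2 L)) => True) s → v s = 0 :=
    fun v => ⟨fun _ s hs => (hs trivial).elim, fun _ => Submodule.mem_top⟩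
  have hcap := sum_canonicalWeight_mul_re_rayleigh_le (fun _ => True) hA hinv hp ⊤ hK hβ
  have htop : A.minEnergyOn ⊤ = A.groundEnergy := Matrix.minEnergyOn_top_holds hA
  rw [htop] at hcap
  -- transport the sum from the subtype to `Fin (sourcedGibbsCount L)`
  set e := sourcedGibbsIndex L with he
  have hsum : ∑ i, sourcedGibbsWeightTT' β tp U μ h L i *
      (expect A (sourcedGibbsVectorTT' tp U μ h L i)).re =
      ∑ a, canonicalWeight β (sectorEigenvalue (fun _ => True) A hA) a *
        (star (sectorEigenvector (fun _ => True) A hA a) ⬝ᵥ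
          (A *ᵥ sectorEigenvector (fun _ => True) A hA a)).re := by
    rw [← Equiv.sum_comp e]
    refine Finset.sum_congr rfl fun i _ => ?_
    rw [sourcedGibbsWeightTT', show sourcedGibbsEnergyTT' tp U μ h L =
      sectorEigenvalue (fun _ => True) A hA ∘ e from funext fun i => sourcedGibbsEnergyTT'_eq tp U μ h L i,
      canonicalWeight_comp_equiv', sourcedGibbsVectorTT'_eq]
    rfl
  have hcard : (Fintype.card (Subtype (fun _ : Finset (Orb (FermionTorus 2 L)) => True)) : ℝ) =
      (sourcedGibbsCount L : ℝ) := rfl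
  rw [hsum, ← hcard]
  exact hcap

/-- The cap with the explicit entropy `L²·log 4`. [cite: Israel1979, Lemma II.3.1] -/
theorem sum_sourcedGibbsWeightTT'_mul_re_expect_le_log_four (L : ℕ) [NeZero L] {β : ℝ} (hβ : 0 < β) :
    ∑ i, sourcedGibbsWeightTT' β tp U μ h L i *
        (expect (dWaveSourceTorusTT' L tp U μ h) (sourcedGibbsVectorTT' tp U μ h L i)).re ≤
      (dWaveSourceTorusTT' L tp U μ h).groundEnergy + Real.log 4 * (L : ℝ) ^ 2 / β :=
  (sum_sourcedGibbsWeightTT'_mul_re_expect_le tp U μ h L hβ).trans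
    (by gcongr; exact log_sourcedGibbsCount_le L)

end TorusGibbs

/-! ### §2 Thermodynamic limits of the thermal states: the sourced energy–entropy window -/

namespace InfVolFermionState

variable (tp U μ h : ℝ)

/-- **The averaged expectation of `E^src` is the sourced energy per site** (all large sides): for `L ≥ L₀`
(injectivity of the window projection and `L ≥ 3`) and every torus vector `ψ`,
`Re (torusAvgExpect L W E^src ψ) = Re⟨ψ, A_L ψ⟩/L²`. [cite: BratteliKishimotoRobinson1978, Thm. 2] -/
theorem exists_forall_re_torusAvgExpect_dWaveSourceEnergyObsTT'_eq :
    ∃ L₀ : ℕ, 3 ≤ L₀ ∧ ∀ (L : ℕ) [NeZero L], L₀ ≤ L → ∀ ψ : Fock (Orb (FermionTorus 2 L)),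
      (torusAvgExpect L dWaveSourceWindow (dWaveSourceEnergyObsTT' tp U μ h) ψ).re =
        (QuantumLattice.expect (dWaveSourceTorusTT' L tp U μ h) ψ).re / (L : ℝ) ^ 2 := by
  obtain ⟨L₁, hL₁⟩ := exists_forall_le_injOn_proj (d := 2) dWaveSourceWindow
  refine ⟨max L₁ 3, le_max_right _ _, fun L _ hL ψ => ?_⟩
  have hInj : Set.InjOn (Torus.proj (d := 2) L) ↑dWaveSourceWindow := hL₁ L ((le_max_left _ _).trans hL)
  have h3 : 3 ≤ L := (le_max_right _ _).trans hL
  rw [torusAvgExpect_eq, torusAvgExpectAt_eq_expect_div_of_sum_relabel (dWaveSourceEnergyObsTT' tp U μ h) L hInj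
    (sum_relabel_translate_dWaveSourceEnergyObsTT' h3 hInj tp U μ h) ψ, ← Complex.ofReal_natCast,
    ← Complex.ofReal_pow, Complex.div_ofReal_re]

/-- **The energy–entropy CAP in the thermodynamic limit.** Let `ω` be a torus limit of the grand-canonical
Gibbs states `ρ_{Ls j,β}` of the pair-sourced tori `A_{Ls j}(t',U,μ,h)` along `Ls → ∞` (`β > 0`). Then
`e_Ψ(ω) ≤ e_src(t',U,μ,h) + (log 4)/β`, `Ψ = hubbardTTPrimeSourcedInteraction 1 t' U μ d h`.
[cite: Israel1979, Lemma II.3.1] [cite: Ruelle1969, §3.4] -/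
theorem IsTorusLimitOfMixture.meanEnergy_sourced_le_dWaveSourceEnergyDensityTT'_add_log_four_div_of_sourcedGibbs
    {β : ℝ} (hβ : 0 < β) {ω : InfVolFermionState 2} {Ls : ℕ → ℕ}
    (hω : ω.IsTorusLimitOfMixture sourcedGibbsCount (fun L => sourcedGibbsWeightTT' β tp U μ h L)
      (fun L => sourcedGibbsVectorTT' tp U μ h L) Ls)
    (hLs : Tendsto Ls atTop atTop) :
    ω.meanEnergy (hubbardTTPrimeSourcedInteraction 1 tp U μ dWaveFormFactor h) 1 ≤
      dWaveSourceEnergyDensityTT' tp U μ h + Real.log 4 / β := by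
  rw [← ω.re_expect_dWaveSourceEnergyObsTT' tp U μ h]
  -- the mixture averages of `E^src` as a function of the side
  set F : ℕ → ℝ := fun L => ∑ i, sourcedGibbsWeightTT' β tp U μ h L i *
    (torusAvgExpect L dWaveSourceWindow (dWaveSourceEnergyObsTT' tp U μ h) (sourcedGibbsVectorTT' tp U μ h L i)).re
    with hF
  set G : ℕ → ℝ := fun K =>
    (dWaveSourceTorusTT' (K + 1) tp U μ h).groundEnergy / (((K + 1 : ℕ) : ℝ)) ^ 2 with hG
  -- convergence of the averages to `Re ω(E^src)` (definition of the mixture torus limit)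
  have hlim : Tendsto (fun j => F (Ls j)) atTop
      (𝓝 (ω.expect dWaveSourceWindow (dWaveSourceEnergyObsTT' tp U μ h)).re) := by
    have hc := (Complex.continuous_re.tendsto _).comp (hω dWaveSourceWindow (dWaveSourceEnergyObsTT' tp U μ h))
    refine hc.congr fun j => ?_
    rw [Function.comp_apply, Complex.re_sum]
    refine Finset.sum_congr rfl fun i _ => ?_
    rw [Complex.re_ofReal_mul]
  -- the finite-volume cap, divided by the volume, for all large sides
  obtain ⟨L₀, h3, hL₀⟩ := exists_forall_re_torusAvgExpect_dWaveSourceEnergyObsTT'_eq tp U μ h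
  have hev : ∀ K : ℕ, L₀ ≤ K + 1 → F (K + 1) ≤ G K + Real.log 4 / β := by
    intro K hK
    have hL2 : (0 : ℝ) < (((K + 1 : ℕ) : ℝ)) ^ 2 := by positivity
    have hcap := sum_sourcedGibbsWeightTT'_mul_re_expect_le_log_four tp U μ h (K + 1) hβ
    have hFK : F (K + 1) = (∑ i, sourcedGibbsWeightTT' β tp U μ h (K + 1) i *
        (QuantumLattice.expect (dWaveSourceTorusTT' (K + 1) tp U μ h) (sourcedGibbsVectorTT' tp U μ h (K + 1) i)).re) /
          (((K + 1 : ℕ) : ℝ)) ^ 2 := by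
      rw [hF, Finset.sum_div]
      refine Finset.sum_congr rfl fun i _ => ?_
      rw [hL₀ (K + 1) hK, mul_div_assoc]
    have hrhs : (G K + Real.log 4 / β) * (((K + 1 : ℕ) : ℝ)) ^ 2 =
        (dWaveSourceTorusTT' (K + 1) tp U μ h).groundEnergy + Real.log 4 * (((K + 1 : ℕ) : ℝ)) ^ 2 / β := by
      rw [hG]
      field_simp
    rw [hFK, div_le_iff₀ hL2, hrhs]
    exact hcap
  -- along `Ls`: `F (Ls j) ≤ G (Ls j − 1) + (log 4)/β` eventually, and `G (Ls j − 1) → e_src`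
  have hK : Tendsto (fun j => Ls j - 1) atTop atTop := (tendsto_sub_atTop_nat 1).comp hLs
  have hconv : Tendsto (fun j => G (Ls j - 1) + Real.log 4 / β) atTop
      (𝓝 (dWaveSourceEnergyDensityTT' tp U μ h + Real.log 4 / β)) :=
    ((tendsto_dWaveSourceEnergyDensityTT' tp U μ h).comp hK).add_const _
  refine le_of_tendsto_of_tendsto hlim hconv ?_
  filter_upwards [hLs.eventually_ge_atTop (max L₀ 1)] with j hj
  have hj1 : 1 ≤ Ls j := (le_max_right _ _).trans hj
  have hle := hev (Ls j - 1) (by omega)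
  rwa [Nat.sub_add_cancel hj1] at hle

/-- **The variational FLOOR for the thermal states**: `e_src(t',U,μ,h) ≤ e_Ψ(ω)` (a mixture torus limit is
translation invariant). [cite: BratteliKishimotoRobinson1978, Thm. 2] -/
theorem IsTorusLimitOfMixture.dWaveSourceEnergyDensityTT'_le_meanEnergy_sourced_of_sourcedGibbs
    (β : ℝ) {ω : InfVolFermionState 2} {Ls : ℕ → ℕ}
    (hω : ω.IsTorusLimitOfMixture sourcedGibbsCount (fun L => sourcedGibbsWeightTT' β tp U μ h L)
      (fun L => sourcedGibbsVectorTT' tp U μ h L) Ls) :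
    dWaveSourceEnergyDensityTT' tp U μ h ≤
      ω.meanEnergy (hubbardTTPrimeSourcedInteraction 1 tp U μ dWaveFormFactor h) 1 :=
  dWaveSourceEnergyDensityTT'_le_meanEnergy_sourced tp U μ h hω.isTranslationInvariant

/-- **The thermal sourced energy WINDOW**: for every torus limit `ω` of the grand-canonical Gibbs states of the
pair-sourced tori at `β > 0`, `e_Ψ(ω) ∈ [e_src, e_src + (log 4)/β]`.
[cite: Israel1979, Lemma II.3.1] [cite: BratteliKishimotoRobinson1978, Thm. 2] -/
theorem IsTorusLimitOfMixture.meanEnergy_sourced_mem_Icc_of_sourcedGibbs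
    {β : ℝ} (hβ : 0 < β) {ω : InfVolFermionState 2} {Ls : ℕ → ℕ}
    (hω : ω.IsTorusLimitOfMixture sourcedGibbsCount (fun L => sourcedGibbsWeightTT' β tp U μ h L)
      (fun L => sourcedGibbsVectorTT' tp U μ h L) Ls)
    (hLs : Tendsto Ls atTop atTop) :
    ω.meanEnergy (hubbardTTPrimeSourcedInteraction 1 tp U μ dWaveFormFactor h) 1 ∈
      Set.Icc (dWaveSourceEnergyDensityTT' tp U μ h) (dWaveSourceEnergyDensityTT' tp U μ h + Real.log 4 / β) :=
  ⟨hω.dWaveSourceEnergyDensityTT'_le_meanEnergy_sourced_of_sourcedGibbs tp U μ h β,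
    hω.meanEnergy_sourced_le_dWaveSourceEnergyDensityTT'_add_log_four_div_of_sourcedGibbs tp U μ h hβ hLs⟩

/-- The same window on the local objective: `Re ω(E^src) ∈ [e_src, e_src + (log 4)/β]`.
[cite: Israel1979, Lemma II.3.1] -/
theorem IsTorusLimitOfMixture.re_expect_dWaveSourceEnergyObsTT'_mem_Icc_of_sourcedGibbs
    {β : ℝ} (hβ : 0 < β) {ω : InfVolFermionState 2} {Ls : ℕ → ℕ}
    (hω : ω.IsTorusLimitOfMixture sourcedGibbsCount (fun L => sourcedGibbsWeightTT' β tp U μ h L)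
      (fun L => sourcedGibbsVectorTT' tp U μ h L) Ls)
    (hLs : Tendsto Ls atTop atTop) :
    (ω.expect dWaveSourceWindow (dWaveSourceEnergyObsTT' tp U μ h)).re ∈
      Set.Icc (dWaveSourceEnergyDensityTT' tp U μ h) (dWaveSourceEnergyDensityTT' tp U μ h + Real.log 4 / β) := by
  rw [ω.re_expect_dWaveSourceEnergyObsTT' tp U μ h]
  exact hω.meanEnergy_sourced_mem_Icc_of_sourcedGibbs tp U μ h hβ hLs

end InfVolFermionState

end Literature.MathematicalPhysics.QuantumLattice

end
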